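import Summits.CriticalPhenomena.PercolationContinuityZ3.Theorems.PercNearOneGluingNoHeavyLowerTailSahiSymCubeFiveSix
import Summits.CriticalPhenomena.PercolationContinuityZ3.Theorems.PercNearOneGluingNoHeavyLowerTailSahiSymCubeMemo
import Summits.CriticalPhenomena.PercolationContinuityZ3.Theorems.PercNearOneGluingNoHeavyLowerTailSahiSymCubeFive7A
import Summits.CriticalPhenomena.PercolationContinuityZ3.Theorems.PercNearOneGluingNoHeavyLowerTailSahiSymCubeFive7B
import Summits.CriticalPhenomena.PercolationContinuityZ3.Theorems.PercNearOneGluingNoHeavyLowerTailSahiSymCubeFive7C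
import Summits.CriticalPhenomena.PercolationContinuityZ3.Theorems.PercNearOneGluingNoHeavyLowerTailSahiSymCubeFive7D
import Summits.CriticalPhenomena.PercolationContinuityZ3.Theorems.PercNearOneGluingNoHeavyLowerTailSahiSymCubeFive7E

/-!
# SAHI'S `C_7` ON THE CUBE `{0,1}^5` FOR EVERY PRODUCT MEASURE (Lean): assembly of the symmetry-reduced coloured-antichain check of order 7

Support file (cell `prim-sahi`, seat `prim-sahi-typer` gen 29; `--supports stmt-CriticalPhenomena-4575`).  Pure proofs; closure = standard axioms
+ the `native_decide` axioms of the computational chunks …`SahiSymCubeFive7A–E` (328 order-7 digit tests with the memoised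
recursion `testM`, one coloured antichain per orbit of `S_5 × S_7`) + those behind …`SahiSymCubeFiveSix` (orders `≤ 6`).

* `symCheckT_five_seven` : `symCheckT 5 7 (testM 5 7 49) = true`;
* **`sahiPositive_bernoulliWeight_seven_fin_five`**: `SahiPositive (bernoulliWeight p) 7` for every `p : Fin 5 → [0,1]` (Sahi's `C_7` for five
  independent coins); `sahiC7_cube_five` — events form; `sahiPositive_bernoulliWeight_fin_five_of_le_seven` — every order `n ≤ 7`. [this work]
-/

namespace Summit.CriticalPhenomena.PercolationContinuityZ3.Theorems.SahiSymCube

open Literature.Combinatorics.Sahi2008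
open Literature.Probability.Percolation.DecisionTree (ind)

/-- **The order-7 symmetry-reduced check on `{0,1}^5` (memoised leaf test) passes** (assembled from the computational chunks). [this work] -/
theorem symCheckT_five_seven : symCheckT 5 7 (testM 5 7 49) = true :=
  symCheck_of_from (symCheckFrom_of_range symCheck_five_7_chunkA
    (symCheckFrom_of_range symCheck_five_7_chunkB
    (symCheckFrom_of_range symCheck_five_7_chunkC
    (symCheckFrom_of_range symCheck_five_7_chunkD symCheck_five_7_chunkE))))

/-- **SAHI'S `C_7` FOR FIVE INDEPENDENT COINS**: `SahiPositive (bernoulliWeight p) 7` for every `p : Fin 5 → [0,1]`. [this work] -/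
theorem sahiPositive_bernoulliWeight_seven_fin_five (p : Fin 5 → unitInterval) : SahiPositive (bernoulliWeight p) 7 :=
  sahiPositive_of_symCheckT (n := 5) (fun A hA p' => testM_sound A hA p') symCheckT_five_seven p
    fun _ _ hk => sahiPositive_bernoulliWeight_fin_five_of_le_six p hk

/-- **Sahi's `C_7` on `{0,1}^5`, events form**: `E_7(μ_p; A) ≥ 0` for increasing events under every product measure. [this work] -/
theorem sahiC7_cube_five (p : Fin 5 → unitInterval) {A : Fin 7 → Set (Set (Fin 5))} (hA : ∀ i, IsUpperSet (A i)) :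
    0 ≤ sahiE (bernoulliWeight p) 7 (fun i => ind (A i)) :=
  sahiPositive_bernoulliWeight_seven_fin_five p _ (fun _ _ => Literature.Probability.Percolation.DecisionTree.ind_nonneg _ _)
    (fun i => monotone_ind_of_isUpperSet (hA i))

/-- **Sahi's conjecture at every order `n ≤ 7` for five independent coins.** [this work] -/
theorem sahiPositive_bernoulliWeight_fin_five_of_le_seven (p : Fin 5 → unitInterval) {n : ℕ} (hn : n ≤ 7) :
    SahiPositive (bernoulliWeight p) n := by
  rcases Nat.lt_or_ge n 7 with h | h
  · exact sahiPositive_bernoulliWeight_fin_five_of_le_six p (by omega)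
  · have : n = 7 := le_antisymm hn h
    subst this
    exact sahiPositive_bernoulliWeight_seven_fin_five p

end Summit.CriticalPhenomena.PercolationContinuityZ3.Theorems.SahiSymCube
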